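import Summits.QuantumFields.YangMills.Theorems.BalabanUVNodesN15NeumannCubeTailRowDefect
import Summits.QuantumFields.YangMills.Theorems.BalabanUVNodesN15NeumannCubeLiftConvolutionDefect
import HarnessLib

/-!
# Route «BalabanUVNodes» (K3⁸ `SpineGivenEndpointR13SepCoPHV`, stmt-QuantumFields-27366), node N15 = NE2, -a lane, PROGRAMME P file P-IIl: THE TAIL ROWS AND THEIR η-DEFECT ON THE TORUS OF
# RECORD — `(−M_h∘N_L∘M_ψ)∘G^{↑}(□ + c)` for the LIFTED Neumann cubes (cube side `L^s` FIXED, volume `M_ν = 2L^{m_T}` FREE): both spacings and the two-grid defect, every analytic letter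
# discharged, constants UNIFORM in the volume (dag-n15-w3 files 44∕45 `hT ∕ hT′ ∕ hDT` for dag-n15-c's record-torus cover FILE 73)

Cell `pub-ymgap`, seat `pub-ymgap-dag-n15-a` (KNIT-BY-NAME, g23; HUMAN RULING D-0062; chair R424 venue; `bears_on: R4∕N15`).  Filed `--kind proof --supports stmt-QuantumFields-27366
--as helper` — COUNT-NEUTRAL.  Theorems only (0 `def`, 0 `sorry`).  Imports BY NAME N-IIu `…NeumannCubeTailRowDefect` (`hasMaj_idef_tailSandwich`, `inv_natPow_le_rpow`; through it N-IIt
`hasMaj_tailSandwich`, `mulOp_chiCube_comp_mulOp`, dag-n15-c FILE 99 `hasMaj_idef_nonlocal_family`, part 47 `hasMaj_landauRe`), P-IIh `…NeumannCubeLiftConvolutionDefect`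
(`hasMaj_idef_chiCube_comp_liftCubeG_record`; through it P-IIe `hasMaj_chiCube_comp_liftCubeG_of`, parts 39∕42 `hasMaj_gOp_of_ineq` ∕ `ineq110_114_pair`); nothing in the tree is modified.

WHY.  dag-n15-c's programme R runs FILE 50's socket on the TORUS OF RECORD with the cover of FILE 73: cubes of fixed side `L^s` LIFTED from their own doubled torus `2L^s` by this lane's
`liftCubeG` (programme P), the volume `2L^{m_T}` free.  The live-background knit there (dag-n15-w3's dressed smooth-cut cubes on that cover) displays the SAME tail rows `hT ∕ hT′ ∕ hDT` with
`N_□ := G^{↑}(□ + c)`; N-IIt ∕ N-IIu typed them on the doubled torus.  THIS FILE lifts them: the sandwich `M_h∘N_L∘M_ψ` lives on the BIG torus (its letters are torus-generic: N-IIt §2,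
N-IIu §1 — `N_L` descends but the cube-local multipliers need not), and behind it the lifted cube propagator costs the method-of-images constant read through `π` (P-IIe (β′), P-IIh).

WHAT.
* §1 ★★★ `hasMaj_tail_liftCubeG_of` — torus pair `M′_ν = 2S ∣ M_ν`, ANY spacing `n`: `(−M_h∘N_L∘M_ψ)∘G^{↑}(□ + c) ≤ 1_□(y)1_□(y′)·2^{d+1}c_N e^{−(δ_N−ρ₁)gap}Ce^{δ₀}c_r·e^{−ρ|y−y′|_T}` from the
  CUBE torus's letter `G′ ≤ Ce^{−δ₀d′}` and the BIG torus's `∂Π∂* ≤ C₁e^{−δ₁d}` (P-IIe `hasMaj_chiCube_comp_liftCubeG_of` at `T₁ :=` N-IIt's sandwich);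
* §2 ★★★ `hasMaj_tail_liftCubeG_pair` — the torus of record `MP (paramsOf d L m_T K hL)`, cube torus `MP (paramsOf d L s K hL)`, `s ≤ m_T`, spacings `L^K` AND `L^r·L^K`: `∃ δ_T δ_g c_T > 0`,
  `≤ 1_□1_□·c_T e^{−δ_g·gap}·e^{−δ_T d}` at both spacings, EVERY analytic letter discharged, constants free of `m_T, s, K, r`;
* §3 ★★★ `hasMaj_idef_tail_liftCubeG` — the η-defect: `∃ δ_T δ_g c_T > 0`, `𝔇(T′_□, T_□) ≤ 1_□1_□·c_T·(o_h + o_ψ + (L^K)^{−γ∕2})·e^{−δ_g·gap}·e^{−δ_T d}` (P-IIh `hasMaj_idef_chiCube_comp_liftCubeG_record`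
  at the sandwich pair, N-IIu §1's defect letter on the big torus with dag-n15-c FILE 99 and part 47), constants free of the volume.

HONEST FRAMING ∕ LIMITS.  Block-majorant bookkeeping over LANDED letters; no new analytic estimate; `U ≡ 1` MODEL of [B6] §2's machine on the torus of record (cube letters from each cube's own
doubled torus via programme P — not circular in the volume); [B5] (1.69) p.29, (1.120)–(1.123) p.37, (1.126) p.38 ∕ [B6] (2.36)–(2.37) p.229, p.238 (T_□), (2.90)–(2.93) p.239, (2.133)–(2.134)
p.247 ∕ [B9] Thm 3.14 pp.426–427 (difference TEMPLATE), (3.63)–(3.65) pp.402–403 = SHAPES ∕ MECHANISM, nothing of [B5]∕[B6]∕[B9] asserted; NE2⁺ NOT PRINTED ∕ NOT proved; N15 NOT discharged;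
K3⁸ OPEN, skeleton v6 untouched; counts of record UNMOVED (typed 28∕28 · discharged 5∕27); one finite 𝕋⁴ at fixed ε — NOT infinite volume, NOT OS on ℝ⁴, NOT a mass gap, NOT Clay; R4 closes
the conditional finite-𝕋⁴ rung `BalabanLadder.UV` only.  Restate-immune (no Theses import).
-/

noncomputable section

open scoped BigOperators
open Finset

namespace Summit.QuantumFields.YangMills.BalabanUVNodes.N15.TwoGrid

open Literature.MathematicalPhysics.QuantumFieldTheory.Balaban1983to89
open Literature.MathematicalPhysics.QuantumFieldTheory.Balaban1983to89.B5Prop11Plancherel (Tor fine)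
open Literature.MathematicalPhysics.QuantumFieldTheory.Balaban1983to89.B6Prop26Gluing (mulOp mulOp_apply ind ind_nonneg ind_le_one)
open Literature.MathematicalPhysics.QuantumFieldTheory.King1986.Torus (blockOf tdistT tdistT_nonneg)
open Literature.MathematicalPhysics.QuantumFieldTheory.Balaban1983to89.B11SectG (BlockNorm HasMaj RowSum)
open Literature.MathematicalPhysics.QuantumFieldTheory.Balaban1983to89.B6UnitTorusCarrier (unitTorusGeo triangle254_unitTorusGeo rowSum_unitTorusGeo)
open Literature.MathematicalPhysics.QuantumFieldTheory.Balaban1983to89.B6RandomWalk (Triangle254)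
open Literature.MathematicalPhysics.QuantumFieldTheory.Balaban1983to89.T4EtaRateDefect (idef idef_apply)
open Literature.MathematicalPhysics.QuantumFieldTheory.Balaban1983to89.T4EtaRateCoeffDefect (pull pull_apply)
open Literature.MathematicalPhysics.QuantumFieldTheory.Balaban1983to89.B5SiteBridgeP12 (MP)
open Summit.QuantumFields.YangMills.BalabanUVNodes.N15.VectorPiece (blkFine kingPrV)
open Summit.QuantumFields.YangMills.BalabanUVNodes.N15.Gluing (hasMaj_idef_nonlocal_family)

variable {d : ℕ}

/-! ## §1 The tail row behind the LIFTED cube propagator, letters displayed (any spacing) -/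

section Row

variable {L : ℕ} (n : ℕ) [NeZero n] {M M' : Fin (d + 1) → ℕ} [∀ μ, NeZero (M μ)] [∀ μ, NeZero (M' μ)] (hM : ∀ μ, M' μ ∣ M μ) (c : Tor M) (S : ℕ) {k : ℕ}

/-- ★★★ **THE TAIL ROW BEHIND THE LIFTED CUBE PROPAGATOR** (torus pair `M′_ν = 2S ∣ M_ν`, any spacing `n`): from the CUBE torus's letter `G′ ≤ Ce^{−δ₀d′}` (Prop. 1.2 (1.110) on `2S`), the BIG
torus's `∂Π∂* ≤ C₁e^{−δ₁d}` ((1.126)), a row sum `c_r` of the big torus at `σ` (`0 ≤ ρ ≤ δ₀`, `ρ + σ ≤ ρ₁ ≤ δ_N ≤ δ₁`), a partition function `|h| ≤ 1` on blocks `H ⊆ □` of the big torus,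
a collar `|ψ| ≤ 1` vanishing on the plateau blocks `A`, `|y − y′|_T ≥ gap` for `y ∈ H`, `y′ ∉ A`:
`(−M_h∘(aQ*Q − ∂Π∂*)∘M_ψ)∘G^{↑}(□ + c) ≤ 1_□(y)1_□(y′)·2^{d+1}·(|a|e^{2δ_N} + C₁)e^{−(δ_N−ρ₁)gap}·Ce^{δ₀}c_r·e^{−ρ|y−y′|_T}` (P-IIe (β′) at N-IIt's sandwich).
[cite: Balaban1984PropagatorsII, (2.36)–(2.37) p.229, p.238 (T_□), (2.90)–(2.93) p.239, (2.133)–(2.134) p.247; Balaban1984PropagatorsI, (1.69) p.29, (1.120)–(1.123) p.37, (1.126)–(1.128) p.38; Balaban1985BackgroundPropagators, (3.63)–(3.65) pp.402–403 (mechanism)] -/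
theorem hasMaj_tail_liftCubeG_of (hM2 : ∀ ν, M' ν = 2 * S) {a C δ₀ C₁ δ₁ δN ρ₁ ρ σ cr gap : ℝ}
    (htri' : Triangle254 (unitTorusGeo L k M')) (hrow : RowSum (unitTorusGeo L k M) σ cr) (hC : 0 ≤ C) (hδ₀ : 0 ≤ δ₀) (hC₁ : 0 ≤ C₁) (hδN : 0 ≤ δN) (hδN₁ : δN ≤ δ₁)
    (hρ₁ : ρ₁ ≤ δN) (hρ : 0 ≤ ρ) (hρδ : ρ ≤ δ₀) (hρσ : ρ + σ ≤ ρ₁)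
    (hG' : HasMaj (BlockNorm.ofBlocks (unitTorusGeo L k M') (fun b : Tor (fine n M') × Fin (d + 1) => blockOf n M' b.1))
      (BlockNorm.ofBlocks (unitTorusGeo L k M') (fun b : Tor (fine n M') × Fin (d + 1) => blockOf n M' b.1)) (gOp M' n a) (fun y y' => C * Real.exp (-(δ₀ * tdistT M' y y'))))
    (hNL : HasMaj (BlockNorm.ofBlocks (unitTorusGeo L k M) (fun b : Tor (fine n M) × Fin (d + 1) => blockOf n M b.1))
      (BlockNorm.ofBlocks (unitTorusGeo L k M) (fun b : Tor (fine n M) × Fin (d + 1) => blockOf n M b.1)) (landauRe M n) (fun y y' => C₁ * Real.exp (-(δ₁ * tdistT M y y'))))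
    {h ψ : Tor (fine n M) × Fin (d + 1) → ℝ} {H A : Set (Tor M)}
    (hh1 : ∀ x, |h x| ≤ 1) (hhH : ∀ x, blockOf n M x.1 ∉ H → h x = 0) (hHc : ∀ y, y ∈ H → y ∈ cubeBlocks M c S)
    (hψ1 : ∀ x, |ψ x| ≤ 1) (hψA : ∀ x, blockOf n M x.1 ∈ A → ψ x = 0) (hgap : ∀ y y', y ∈ H → y' ∉ A → gap ≤ tdistT M y y') :
    HasMaj (BlockNorm.ofBlocks (unitTorusGeo L k M) (fun b : Tor (fine n M) × Fin (d + 1) => blockOf n M b.1))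
      (BlockNorm.ofBlocks (unitTorusGeo L k M) (fun b : Tor (fine n M) × Fin (d + 1) => blockOf n M b.1))
      ((-(mulOp h ∘ₗ (a • (qvAdjRe M n ∘ₗ qvRe M n) + (-landauRe M n)) ∘ₗ mulOp ψ)) ∘ₗ liftCubeG n hM c S a)
      (fun y y' => ind (cubeBlocks M c S : Set (Tor M)) y * ind (cubeBlocks M c S : Set (Tor M)) y' *
        (2 ^ (d + 1) * ((|a| * (Real.exp δN * Real.exp δN) + C₁) * Real.exp (-((δN - ρ₁) * gap)) * (C * Real.exp δ₀) * cr) * Real.exp (-(ρ * tdistT M y y')))) := by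
  have ha₁ : 0 ≤ (|a| * (Real.exp δN * Real.exp δN) + C₁) * Real.exp (-((δN - ρ₁) * gap)) := by positivity
  have hT₁ : HasMaj (BlockNorm.ofBlocks (unitTorusGeo L k M) (fun b : Tor (fine n M) × Fin (d + 1) => blockOf n M b.1))
      (BlockNorm.ofBlocks (unitTorusGeo L k M) (fun b : Tor (fine n M) × Fin (d + 1) => blockOf n M b.1))
      (mulOp h ∘ₗ (a • (qvAdjRe M n ∘ₗ qvRe M n) + (-landauRe M n)) ∘ₗ mulOp ψ)
      (fun y y' => (|a| * (Real.exp δN * Real.exp δN) + C₁) * Real.exp (-((δN - ρ₁) * gap)) * Real.exp (-(ρ₁ * tdistT M y y'))) := by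
    refine (hasMaj_tailSandwich (L := L) (k := k) (a := a) hC₁ hδN hδN₁ hρ₁ hNL hh1 hhH hψ1 hψA hgap).mono fun y y' => ?_
    have hX : 0 ≤ (|a| * (Real.exp δN * Real.exp δN) + C₁) * Real.exp (-((δN - ρ₁) * gap)) * Real.exp (-(ρ₁ * tdistT M y y')) := by positivity
    calc ind H y * ((|a| * (Real.exp δN * Real.exp δN) + C₁) * Real.exp (-((δN - ρ₁) * gap)) * Real.exp (-(ρ₁ * tdistT M y y')))
        ≤ 1 * ((|a| * (Real.exp δN * Real.exp δN) + C₁) * Real.exp (-((δN - ρ₁) * gap)) * Real.exp (-(ρ₁ * tdistT M y y'))) :=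
          mul_le_mul_of_nonneg_right (ind_le_one _ _) hX
      _ = _ := one_mul _
  have key := hasMaj_chiCube_comp_liftCubeG_of n hM c S hM2 htri' hrow hC hδ₀ ha₁ hρ hρδ hρσ hT₁ hG'
  have hcut := mulOp_chiCube_comp_mulOp (n := n) (c := c) (S := S) hhH hHc
  refine key.neg.congr fun μ => ?_
  simp only [LinearMap.neg_apply, LinearMap.comp_apply]
  congr 1
  exact LinearMap.congr_fun hcut _

end Row

/-! ## §2 Both spacings on the torus family of record, every analytic letter discharged, constants free of the volume -/

section Pair

variable {L : ℕ} [NeZero L]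

/-- ★★★ **THE TAIL ROWS OF THE LIFTED CUBES ON THE TORUS OF RECORD, BOTH SPACINGS** (dag-n15-w3 files 44∕45 `hT ∕ hT′` for dag-n15-c's record cover FILE 73): for odd `L > 1`, `a > 0` there are
`δ_T, δ_g, c_T > 0` such that for EVERY cube exponent `s`, volume `m_T ≥ s`, level `K ≥ 1`, refinement `r`, corner `c` of `Tor (2L^{m_T})`, EVERY `h, ψ, H ⊆ □, A, gap` with the support ∕
plateau ∕ gap hypotheses: at the spacing `L^K` AND at `L^r·L^K`, `(−M_h∘(aQ*Q − ∂Π∂*)∘M_ψ)∘G^{↑}(□ + c) ≤ 1_□(y)1_□(y′)·c_T e^{−δ_g·gap}·e^{−δ_T|y−y′|_T}` — constants free of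
`s, m_T, K, r`.  Letters: [B5] Prop. 1.2 (1.110) on the cube tori `2L^s` (`ineq110_114_pair`, `hasMaj_gOp_of_ineq`), (1.126) on the big torus (`hasMaj_landauRe`), (2.61) row sums.
[cite: Balaban1984PropagatorsI, Prop. 1.2 (1.110) p.35, (1.126) p.38; Balaban1984PropagatorsII, (2.36)–(2.37) p.229, Lemma 2.1 (2.61) p.234, p.238 (T_□), (2.90)–(2.93) p.239, (2.133)–(2.134) p.247; Balaban1985BackgroundPropagators, (3.63)–(3.65) pp.402–403 (mechanism)] -/
theorem hasMaj_tail_liftCubeG_pair (hL : Odd L ∧ 1 < L) {a : ℝ} (ha : 0 < a) :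
    ∃ δT δg cT : ℝ, 0 < δT ∧ 0 < δg ∧ 0 < cT ∧ ∀ (s mT K r : ℕ) (hs : s ≤ mT) (hK : 1 ≤ K) (c : Tor (MP (paramsOf d L mT K hL))) (H A : Set (Tor (MP (paramsOf d L mT K hL)))) (gap : ℝ),
      (∀ y, y ∈ H → y ∈ cubeBlocks (MP (paramsOf d L mT K hL)) c (L ^ s)) →
      (∀ y y', y ∈ H → y' ∉ A → gap ≤ tdistT (MP (paramsOf d L mT K hL)) y y') →
      (∀ (h ψ : Tor (fine (L ^ K) (MP (paramsOf d L mT K hL))) × Fin (d + 1) → ℝ),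
        (∀ x, |h x| ≤ 1) → (∀ x, blockOf (L ^ K) (MP (paramsOf d L mT K hL)) x.1 ∉ H → h x = 0) →
        (∀ x, |ψ x| ≤ 1) → (∀ x, blockOf (L ^ K) (MP (paramsOf d L mT K hL)) x.1 ∈ A → ψ x = 0) →
        HasMaj (BlockNorm.ofBlocks (unitTorusGeo L K (MP (paramsOf d L mT K hL))) (blkFine L K (MP (paramsOf d L mT K hL))))
          (BlockNorm.ofBlocks (unitTorusGeo L K (MP (paramsOf d L mT K hL))) (blkFine L K (MP (paramsOf d L mT K hL))))
          ((-(mulOp h ∘ₗ (a • (qvAdjRe (MP (paramsOf d L mT K hL)) (L ^ K) ∘ₗ qvRe (MP (paramsOf d L mT K hL)) (L ^ K)) + (-landauRe (MP (paramsOf d L mT K hL)) (L ^ K))) ∘ₗ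
              mulOp ψ)) ∘ₗ liftCubeG (L ^ K) (MP_dvd_MP hL hs K) c (L ^ s) a)
          (fun y y' => ind ((cubeBlocks (MP (paramsOf d L mT K hL)) c (L ^ s) : Finset _) : Set _) y *
            ind ((cubeBlocks (MP (paramsOf d L mT K hL)) c (L ^ s) : Finset _) : Set _) y' *
            (cT * Real.exp (-(δg * gap)) * Real.exp (-(δT * tdistT (MP (paramsOf d L mT K hL)) y y'))))) ∧
      (∀ (h ψ : Tor (fine (L ^ r * L ^ K) (MP (paramsOf d L mT K hL))) × Fin (d + 1) → ℝ),
        (∀ x, |h x| ≤ 1) → (∀ x, blockOf (L ^ r * L ^ K) (MP (paramsOf d L mT K hL)) x.1 ∉ H → h x = 0) →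
        (∀ x, |ψ x| ≤ 1) → (∀ x, blockOf (L ^ r * L ^ K) (MP (paramsOf d L mT K hL)) x.1 ∈ A → ψ x = 0) →
        HasMaj (BlockNorm.ofBlocks (unitTorusGeo L K (MP (paramsOf d L mT K hL)))
            (fun i : Tor (fine (L ^ r * L ^ K) (MP (paramsOf d L mT K hL))) × Fin (d + 1) => blockOf (L ^ r * L ^ K) (MP (paramsOf d L mT K hL)) i.1))
          (BlockNorm.ofBlocks (unitTorusGeo L K (MP (paramsOf d L mT K hL)))
            (fun i : Tor (fine (L ^ r * L ^ K) (MP (paramsOf d L mT K hL))) × Fin (d + 1) => blockOf (L ^ r * L ^ K) (MP (paramsOf d L mT K hL)) i.1))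
          ((-(mulOp h ∘ₗ (a • (qvAdjRe (MP (paramsOf d L mT K hL)) (L ^ r * L ^ K) ∘ₗ qvRe (MP (paramsOf d L mT K hL)) (L ^ r * L ^ K)) +
              (-landauRe (MP (paramsOf d L mT K hL)) (L ^ r * L ^ K))) ∘ₗ mulOp ψ)) ∘ₗ liftCubeG (L ^ r * L ^ K) (MP_dvd_MP hL hs K) c (L ^ s) a)
          (fun y y' => ind ((cubeBlocks (MP (paramsOf d L mT K hL)) c (L ^ s) : Finset _) : Set _) y *
            ind ((cubeBlocks (MP (paramsOf d L mT K hL)) c (L ^ s) : Finset _) : Set _) y' *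
            (cT * Real.exp (-(δg * gap)) * Real.exp (-(δT * tdistT (MP (paramsOf d L mT K hL)) y y'))))) := by
  obtain ⟨δ₀, C, Cα, Cε, Cαε, hδ₀, hC, HG⟩ := ineq110_114_pair (d := d) hL ha
  obtain ⟨δ₁, C₁, hδ₁, hC₁, HN⟩ := hasMaj_landauRe (d := d) (L := L)
  obtain ⟨δm, hδm⟩ : ∃ δm : ℝ, δm = min δ₀ δ₁ := ⟨_, rfl⟩
  have hδm0 : 0 < δm := by rw [hδm]; exact lt_min hδ₀ hδ₁
  have hδm₀ : δm ≤ δ₀ := by rw [hδm]; exact min_le_left _ _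
  have hδm₁ : δm ≤ δ₁ := by rw [hδm]; exact min_le_right _ _
  obtain ⟨cr, hcr⟩ : ∃ cr : ℝ, cr = B4Sect5Proof.latticeConst (d + 1) (δm / 4) := ⟨_, rfl⟩
  have hcr0 : 0 ≤ cr := by
    have h := (rowSum_unitTorusGeo L 0 (MP (paramsOf d L 0 0 hL)) (by positivity : 0 < δm / 4)).nonneg (fun _ => 0)
    rw [hcr]; exact h
  have hcN : 0 ≤ 2 ^ (d + 1) * ((|a| * (Real.exp δm * Real.exp δm) + C₁) * (C * Real.exp δ₀) * cr) := by positivity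
  refine ⟨δm / 4, δm / 2, 2 ^ (d + 1) * ((|a| * (Real.exp δm * Real.exp δm) + C₁) * (C * Real.exp δ₀) * cr) + 1, by positivity, by positivity, by positivity,
    fun s mT K r hs hK c H A gap hHc hgap => ?_⟩
  have hM2 : ∀ ν, MP (paramsOf d L s K hL) ν = 2 * L ^ s := fun ν => rfl
  have htri' := triangle254_unitTorusGeo L K (MP (paramsOf d L s K hL))
  have hrow : RowSum (unitTorusGeo L K (MP (paramsOf d L mT K hL))) (δm / 4) cr := by
    rw [hcr]; exact rowSum_unitTorusGeo L K (MP (paramsOf d L mT K hL)) (by positivity : 0 < δm / 4)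
  have hρσ : δm / 4 + δm / 4 ≤ δm / 2 := by linarith
  have hρ₁ : δm / 2 ≤ δm := by linarith
  have hgap' : δm - δm / 2 = δm / 2 := by ring
  have hAB : 2 ^ (d + 1) * ((|a| * (Real.exp δm * Real.exp δm) + C₁) * Real.exp (-(δm / 2 * gap)) * (C * Real.exp δ₀) * cr) ≤
      (2 ^ (d + 1) * ((|a| * (Real.exp δm * Real.exp δm) + C₁) * (C * Real.exp δ₀) * cr) + 1) * Real.exp (-(δm / 2 * gap)) := by
    have hE : 0 ≤ Real.exp (-(δm / 2 * gap)) := Real.exp_nonneg _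
    nlinarith [mul_nonneg hcN hE]
  refine ⟨fun h ψ hh1 hhH hψ1 hψA => ?_, fun h ψ hh1 hhH hψ1 hψA => ?_⟩
  · have hn : 1 ≤ L ^ K := Nat.one_le_pow _ _ (Nat.pos_of_ne_zero (NeZero.ne L))
    have hG' := hasMaj_gOp_of_ineq (L := L) (k := K) _ _ a hn (HG s K r hK).1 hC.le
    have hNL := HN K (L ^ K) (MP (paramsOf d L mT K hL))
    refine (hasMaj_tail_liftCubeG_of (L := L) (k := K) (L ^ K) (MP_dvd_MP hL hs K) c (L ^ s) hM2 htri' hrow hC.le hδ₀.le hC₁.le hδm0.le hδm₁ hρ₁ (by positivity) (by linarith)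
      hρσ hG' hNL hh1 hhH hHc hψ1 hψA hgap).mono fun y y' => ?_
    rw [hgap']
    exact ind_mul_ind_mul_mono hAB (Real.exp_nonneg _) y y'
  · have hn' : 1 ≤ L ^ r * L ^ K := Nat.one_le_iff_ne_zero.mpr (Nat.mul_ne_zero (pow_ne_zero r (NeZero.ne L)) (pow_ne_zero K (NeZero.ne L)))
    haveI : NeZero (L ^ r * L ^ K) := ⟨by positivity⟩
    have hG' := hasMaj_gOp_of_ineq (L := L) (k := K) _ _ a hn' (HG s K r hK).2 hC.le
    have hNL := HN K (L ^ r * L ^ K) (MP (paramsOf d L mT K hL))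
    refine (hasMaj_tail_liftCubeG_of (L := L) (k := K) (L ^ r * L ^ K) (MP_dvd_MP hL hs K) c (L ^ s) hM2 htri' hrow hC.le hδ₀.le hC₁.le hδm0.le hδm₁ hρ₁ (by positivity)
      (by linarith) hρσ hG' hNL hh1 hhH hHc hψ1 hψA hgap).mono fun y y' => ?_
    rw [hgap']
    exact ind_mul_ind_mul_mono hAB (Real.exp_nonneg _) y y'

end Pair

/-! ## §3 The η-defect of the tail rows of the lifted cubes, every analytic letter discharged, constants free of the volume -/

section Defect

variable {L : ℕ} [NeZero L]

/-- ★★★ **THE η-DEFECT OF THE TAIL ROWS ON THE TORUS OF RECORD** (dag-n15-w3 file 45 `hDT` for dag-n15-c's record cover): for odd `L ≥ 3`, `a > 0`, `0 < γ < 1` there are `δ_T, δ_g, c_T > 0` such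
that for EVERY `s ≤ m_T`, `k ≥ 1`, `r`, corner `c`, EVERY `h, ψ` (coarse, spacing `L^k`) and `h′, ψ′` (fine, `L^r·L^k`) on the BIG torus with the support ∕ plateau hypotheses (`H ⊆ □`, plateau
blocks `A`), fits `|h′ − h∘π| ≤ o_h`, `|ψ′ − ψ∘π| ≤ o_ψ` and `|y − y′|_T ≥ gap` for `y ∈ H`, `y′ ∉ A`:
`𝔇((−M_{h′}N′_LM_{ψ′})∘G′^{↑}(□ + c), (−M_hN_LM_ψ)∘G^{↑}(□ + c)) ≤ 1_□(y)1_□(y′)·c_T·(o_h + o_ψ + (L^k)^{−γ∕2})·e^{−δ_g·gap}·e^{−δ_T|y−y′|_T}` — constants free of `m_T, s, k, r`.  P-IIh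
`hasMaj_idef_chiCube_comp_liftCubeG_record` (cube-torus letters of programme N: `hasMaj_gOp`, `hasMaj_entries110`, `hasMaj_twoGridDefect`) at the sandwich pair, whose fine letter and
η-defect live on the BIG torus (N-IIt `hasMaj_tailSandwich`, N-IIu `hasMaj_idef_tailSandwich` with `hasMaj_landauRe` and dag-n15-c FILE 99 `hasMaj_idef_nonlocal_family`).
[cite: Balaban1985BackgroundPropagators, Thm 3.14 pp.426–427 (difference template), (3.63)–(3.65) pp.402–403 (mechanism); Balaban1984PropagatorsII, (2.36)–(2.37) p.229, Lemma 2.1 (2.61) p.234, p.238 (T_□), (2.90)–(2.93) p.239, (2.133)–(2.134) p.247; Balaban1984PropagatorsI, (1.69) p.29, Prop. 1.2 (1.110) p.35, (1.120)–(1.123) p.37, (1.126) p.38; King1986, Prop. 3.8 (3.71) p.664, Prop. 3.9 (3.73) p.665 (η-rate shape)] -/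
theorem hasMaj_idef_tail_liftCubeG (hLodd : Odd L) (hL2 : 2 ≤ L) {a : ℝ} (ha : 0 < a) {γ : ℝ} (hγ0 : 0 < γ) (hγ1 : γ < 1) :
    ∃ δT δg cT : ℝ, 0 < δT ∧ 0 < δg ∧ 0 < cT ∧ ∀ (s mT k r : ℕ) (hk : 1 ≤ k) (hL : Odd L ∧ 1 < L) (hs : s ≤ mT)
      (c : Tor (MP (paramsOf d L mT k hL))) (H A : Set (Tor (MP (paramsOf d L mT k hL)))) (gap oh oψ : ℝ), 0 ≤ oh → 0 ≤ oψ →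
      (∀ y, y ∈ H → y ∈ cubeBlocks (MP (paramsOf d L mT k hL)) c (L ^ s)) →
      (∀ y y', y ∈ H → y' ∉ A → gap ≤ tdistT (MP (paramsOf d L mT k hL)) y y') →
      ∀ (h ψ : Tor (fine (L ^ k) (MP (paramsOf d L mT k hL))) × Fin (d + 1) → ℝ) (h' ψ' : Tor (fine (L ^ r * L ^ k) (MP (paramsOf d L mT k hL))) × Fin (d + 1) → ℝ),
        (∀ x, blockOf (L ^ k) (MP (paramsOf d L mT k hL)) x.1 ∉ H → h x = 0) →
        (∀ x, |ψ x| ≤ 1) → (∀ x, blockOf (L ^ k) (MP (paramsOf d L mT k hL)) x.1 ∈ A → ψ x = 0) →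
        (∀ x', |h' x'| ≤ 1) → (∀ x', blockOf (L ^ r * L ^ k) (MP (paramsOf d L mT k hL)) x'.1 ∉ H → h' x' = 0) →
        (∀ x', |ψ' x'| ≤ 1) → (∀ x', blockOf (L ^ r * L ^ k) (MP (paramsOf d L mT k hL)) x'.1 ∈ A → ψ' x' = 0) →
        (∀ x', |h' x' - h (kingPrV L k r (MP (paramsOf d L mT k hL)) x')| ≤ oh) → (∀ x', |ψ' x' - ψ (kingPrV L k r (MP (paramsOf d L mT k hL)) x')| ≤ oψ) →
        HasMaj (BlockNorm.ofBlocks (unitTorusGeo L k (MP (paramsOf d L mT k hL))) (blkFine L k (MP (paramsOf d L mT k hL))))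
          (BlockNorm.ofBlocks (unitTorusGeo L k (MP (paramsOf d L mT k hL)))
            (fun i : Tor (fine (L ^ r * L ^ k) (MP (paramsOf d L mT k hL))) × Fin (d + 1) => blockOf (L ^ r * L ^ k) (MP (paramsOf d L mT k hL)) i.1))
          (idef (pull (kingPrV L k r (MP (paramsOf d L mT k hL)))) (pull (kingPrV L k r (MP (paramsOf d L mT k hL))))
            ((-(mulOp h' ∘ₗ (a • (qvAdjRe (MP (paramsOf d L mT k hL)) (L ^ r * L ^ k) ∘ₗ qvRe (MP (paramsOf d L mT k hL)) (L ^ r * L ^ k)) +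
                (-landauRe (MP (paramsOf d L mT k hL)) (L ^ r * L ^ k))) ∘ₗ mulOp ψ')) ∘ₗ liftCubeG (L ^ r * L ^ k) (MP_dvd_MP hL hs k) c (L ^ s) a)
            ((-(mulOp h ∘ₗ (a • (qvAdjRe (MP (paramsOf d L mT k hL)) (L ^ k) ∘ₗ qvRe (MP (paramsOf d L mT k hL)) (L ^ k)) +
                (-landauRe (MP (paramsOf d L mT k hL)) (L ^ k))) ∘ₗ mulOp ψ)) ∘ₗ liftCubeG (L ^ k) (MP_dvd_MP hL hs k) c (L ^ s) a))
          (fun y y' => ind ((cubeBlocks (MP (paramsOf d L mT k hL)) c (L ^ s) : Finset _) : Set _) y * ind ((cubeBlocks (MP (paramsOf d L mT k hL)) c (L ^ s) : Finset _) : Set _) y' *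
            (cT * (oh + oψ + ((L ^ k : ℕ) : ℝ) ^ (-(γ / 2))) * Real.exp (-(δg * gap)) * Real.exp (-(δT * tdistT (MP (paramsOf d L mT k hL)) y y')))) := by
  have hL : Odd L ∧ 1 < L := ⟨hLodd, by omega⟩
  obtain ⟨δ₀, CG, CD, C₁, hδ₀, hCG, hCD, hC₁, HR⟩ := hasMaj_idef_chiCube_comp_liftCubeG_record (d := d) hLodd hL2 ha hγ0 hγ1
  obtain ⟨δΛ, CΛ, hδΛ, hCΛ, HΛ⟩ := hasMaj_landauRe (d := d) (L := L)
  obtain ⟨δND, rND, hδND, hrND, HND⟩ := hasMaj_idef_nonlocal_family (d := d) hLodd hL2 ha hγ0 hγ1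
  obtain ⟨δN, hδNdef⟩ : ∃ δN : ℝ, δN = min δΛ δND := ⟨_, rfl⟩
  have hδN : 0 < δN := by rw [hδNdef]; exact lt_min hδΛ hδND
  have hδNΛ : δN ≤ δΛ := by rw [hδNdef]; exact min_le_left _ _
  have hδNN : δN ≤ δND := by rw [hδNdef]; exact min_le_right _ _
  obtain ⟨ρ, hρdef⟩ : ∃ ρ : ℝ, ρ = min δ₀ (δN / 4) := ⟨_, rfl⟩
  have hρ : 0 < ρ := by rw [hρdef]; exact lt_min hδ₀ (by positivity)
  have hρδ : ρ ≤ δ₀ := by rw [hρdef]; exact min_le_left _ _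
  have hρN : ρ ≤ δN / 4 := by rw [hρdef]; exact min_le_right _ _
  obtain ⟨cr, hcrdef⟩ : ∃ cr : ℝ, cr = B4Sect5Proof.latticeConst (d + 1) (δN / 4) := ⟨_, rfl⟩
  have hcr : 0 ≤ cr := by
    have h := (rowSum_unitTorusGeo L 0 (MP (paramsOf d L 0 0 hL)) (by positivity : 0 < δN / 4)).nonneg (fun _ => 0)
    rw [hcrdef]; exact h
  obtain ⟨cN, hcNdef⟩ : ∃ cN : ℝ, cN = |a| * (Real.exp δN * Real.exp δN) + CΛ := ⟨_, rfl⟩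
  have hcN : 0 ≤ cN := by rw [hcNdef]; positivity
  obtain ⟨cT, hcTdef⟩ : ∃ cT : ℝ, cT = 2 ^ (d + 1) * Real.exp δ₀ * cr * (cN * CD + cN * ((d + 1) * C₁) + cN * CG + rND * CG) + 1 := ⟨_, rfl⟩
  have hcT : 0 < cT := by rw [hcTdef]; positivity
  refine ⟨ρ, δN / 2, cT, hρ, by positivity, hcT, fun s mT k r hk hL' hs c H A gap oh oψ hoh hoψ hHc hgap h ψ h' ψ' hhH hψ1 hψA hh1' hhH' hψ1' hψA' hfh hfψ => ?_⟩
  have hn1 : 1 ≤ L ^ k := Nat.one_le_pow _ _ (by omega)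
  have hnr1 : (1 : ℝ) ≤ ((L ^ k : ℕ) : ℝ) := by exact_mod_cast hn1
  have hnr0 : (0 : ℝ) < ((L ^ k : ℕ) : ℝ) := by linarith
  haveI : NeZero (L ^ r * L ^ k) := ⟨Nat.mul_ne_zero (pow_ne_zero r (NeZero.ne L)) (pow_ne_zero k (NeZero.ne L))⟩
  obtain ⟨ρk, hρkdef⟩ : ∃ ρk : ℝ, ρk = ((L ^ k : ℕ) : ℝ) ^ (-(γ / 2)) := ⟨_, rfl⟩
  have hρk0 : 0 ≤ ρk := by rw [hρkdef]; exact Real.rpow_nonneg hnr0.le _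
  have hrow : RowSum (unitTorusGeo L k (MP (paramsOf d L mT k hL'))) (δN / 4) cr := by
    rw [hcrdef]; exact rowSum_unitTorusGeo L k (MP (paramsOf d L mT k hL')) (by positivity : 0 < δN / 4)
  -- the big torus's nonlocal letters
  have hNL := HΛ k (L ^ k) (MP (paramsOf d L mT k hL'))
  have hNL' := HΛ k (L ^ r * L ^ k) (MP (paramsOf d L mT k hL'))
  have HND' := HND mT k r hk hL'
  rw [← hρkdef] at HND'
  have hDN := hasMaj_rate_mono (mul_nonneg hrND.le hρk0) hδNN HND'
  -- the fine sandwich letter and the sandwich's defect on the big torus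
  have hT' : HasMaj (BlockNorm.ofBlocks (unitTorusGeo L k (MP (paramsOf d L mT k hL')))
        (fun b : Tor (fine (L ^ r * L ^ k) (MP (paramsOf d L mT k hL'))) × Fin (d + 1) => blockOf (L ^ r * L ^ k) (MP (paramsOf d L mT k hL')) b.1))
      (BlockNorm.ofBlocks (unitTorusGeo L k (MP (paramsOf d L mT k hL')))
        (fun b : Tor (fine (L ^ r * L ^ k) (MP (paramsOf d L mT k hL'))) × Fin (d + 1) => blockOf (L ^ r * L ^ k) (MP (paramsOf d L mT k hL')) b.1))
      (mulOp h' ∘ₗ (a • (qvAdjRe (MP (paramsOf d L mT k hL')) (L ^ r * L ^ k) ∘ₗ qvRe (MP (paramsOf d L mT k hL')) (L ^ r * L ^ k)) +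
        (-landauRe (MP (paramsOf d L mT k hL')) (L ^ r * L ^ k))) ∘ₗ mulOp ψ')
      (fun y y' => cN * Real.exp (-((δN - δN / 2) * gap)) * Real.exp (-(δN / 2 * tdistT (MP (paramsOf d L mT k hL')) y y'))) := by
    rw [hcNdef]
    refine (hasMaj_tailSandwich (L := L) (k := k) (a := a) hCΛ.le hδN.le hδNΛ (by linarith : δN / 2 ≤ δN) hNL' hh1' hhH' hψ1' hψA' hgap).mono fun y y' => ?_
    have hX : 0 ≤ (|a| * (Real.exp δN * Real.exp δN) + CΛ) * Real.exp (-((δN - δN / 2) * gap)) * Real.exp (-(δN / 2 * tdistT (MP (paramsOf d L mT k hL')) y y')) := by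
      positivity
    calc ind H y * ((|a| * (Real.exp δN * Real.exp δN) + CΛ) * Real.exp (-((δN - δN / 2) * gap)) * Real.exp (-(δN / 2 * tdistT (MP (paramsOf d L mT k hL')) y y')))
        ≤ 1 * ((|a| * (Real.exp δN * Real.exp δN) + CΛ) * Real.exp (-((δN - δN / 2) * gap)) * Real.exp (-(δN / 2 * tdistT (MP (paramsOf d L mT k hL')) y y'))) :=
          mul_le_mul_of_nonneg_right (ind_le_one _ _) hX
      _ = _ := one_mul _
  have hDT := hasMaj_idef_tailSandwich (L := L) (k := k) (r := r) (a := a) hCΛ.le hδN.le hδNΛ (by linarith : δN / 2 ≤ δN) (mul_nonneg hrND.le hρk0) hoh hoψ hNL hNL' hDN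
    hhH hψ1 hψA hh1' hhH' hψA' hfh hfψ hgap
  rw [← hcNdef] at hDT
  have ha₁ : 0 ≤ cN * Real.exp (-((δN - δN / 2) * gap)) := by positivity
  have hr₁ : 0 ≤ (cN * oψ + rND * ρk + oh * cN) * Real.exp (-((δN - δN / 2) * gap)) := by positivity
  have key := HR s mT k r hk hL' hs c _ _ hrow ha₁ hr₁ hρ.le hρδ (by linarith : ρ + δN / 4 ≤ δN / 2) hT' hDT
  rw [← hρkdef] at key
  -- remove the cube's cut behind the partition functions, move the sign out
  have hcut := mulOp_chiCube_comp_mulOp (n := L ^ k) (c := c) (S := L ^ s) hhH hHc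
  have hcut' := mulOp_chiCube_comp_mulOp (n := L ^ r * L ^ k) (c := c) (S := L ^ s) hhH' hHc
  -- (no `rw [LinearMap.neg_comp, idef_neg]` on an `MP (paramsOf …)` goal: `(paramsOf …).d` vs `d + 1` at reducible transparency — the generic identity N-IIu `idef_neg_cutTail_eq` through `congr`)
  have e := idef_neg_cutTail_eq (kingPrV L k r (MP (paramsOf d L mT k hL')))
    ((a • (qvAdjRe (MP (paramsOf d L mT k hL')) (L ^ k) ∘ₗ qvRe (MP (paramsOf d L mT k hL')) (L ^ k)) + (-landauRe (MP (paramsOf d L mT k hL')) (L ^ k))) ∘ₗ mulOp ψ)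
    (liftCubeG (L ^ k) (MP_dvd_MP hL' hs k) c (L ^ s) a)
    ((a • (qvAdjRe (MP (paramsOf d L mT k hL')) (L ^ r * L ^ k) ∘ₗ qvRe (MP (paramsOf d L mT k hL')) (L ^ r * L ^ k)) +
      (-landauRe (MP (paramsOf d L mT k hL')) (L ^ r * L ^ k))) ∘ₗ mulOp ψ')
    (liftCubeG (L ^ r * L ^ k) (MP_dvd_MP hL' hs k) c (L ^ s) a) hcut hcut'
  refine (key.neg.mono fun y y' => ?_).congr fun μ => (LinearMap.congr_fun e μ).symm
  have hI : 0 ≤ ind (g := unitTorusGeo L k (MP (paramsOf d L mT k hL'))) ((cubeBlocks (MP (paramsOf d L mT k hL')) c (L ^ s) : Finset _) : Set _) y *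
      ind (g := unitTorusGeo L k (MP (paramsOf d L mT k hL'))) ((cubeBlocks (MP (paramsOf d L mT k hL')) c (L ^ s) : Finset _) : Set _) y' :=
    mul_nonneg (ind_nonneg _ _) (ind_nonneg _ _)
  refine mul_le_mul_of_nonneg_left (mul_le_mul_of_nonneg_right ?_ (Real.exp_nonneg _)) hI
  have hgap' : δN - δN / 2 = δN / 2 := by ring
  rw [hgap']
  obtain ⟨Eg, hEgdef⟩ : ∃ Eg : ℝ, Eg = Real.exp (-(δN / 2 * gap)) := ⟨_, rfl⟩
  rw [← hEgdef]
  have hEg : 0 ≤ Eg := by rw [hEgdef]; exact Real.exp_nonneg _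
  have hinv : 1 / ((L ^ k : ℕ) : ℝ) ≤ ρk := by rw [hρkdef]; exact inv_natPow_le_rpow (L := L) hnr1 (by linarith)
  have t2 : (d + 1) * (C₁ / ((L ^ k : ℕ) : ℝ)) ≤ (d + 1) * C₁ * ρk := by
    rw [div_eq_mul_one_div, ← mul_assoc]; exact mul_le_mul_of_nonneg_left hinv (by positivity)
  have hB : 0 ≤ oh + oψ + ρk := by positivity
  have hρkB : ρk ≤ oh + oψ + ρk := by linarith
  have e1 : cN * Eg * (CD * ρk) ≤ Eg * (cN * CD) * (oh + oψ + ρk) :=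
    calc cN * Eg * (CD * ρk) = Eg * (cN * CD) * ρk := by ring
      _ ≤ Eg * (cN * CD) * (oh + oψ + ρk) := mul_le_mul_of_nonneg_left hρkB (by positivity)
  have e2 : cN * Eg * ((d + 1) * (C₁ / ((L ^ k : ℕ) : ℝ))) ≤ Eg * (cN * ((d + 1) * C₁)) * (oh + oψ + ρk) :=
    calc cN * Eg * ((d + 1) * (C₁ / ((L ^ k : ℕ) : ℝ))) ≤ cN * Eg * ((d + 1) * C₁ * ρk) := mul_le_mul_of_nonneg_left t2 (mul_nonneg hcN hEg)
      _ = Eg * (cN * ((d + 1) * C₁)) * ρk := by ring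
      _ ≤ Eg * (cN * ((d + 1) * C₁)) * (oh + oψ + ρk) := mul_le_mul_of_nonneg_left hρkB (by positivity)
  have e3 : (cN * oψ + rND * ρk + oh * cN) * Eg * CG ≤ Eg * (cN * CG + rND * CG) * (oh + oψ + ρk) := by
    have f1 : Eg * (cN * CG) * oψ + Eg * (cN * CG) * oh ≤ Eg * (cN * CG) * (oh + oψ + ρk) := by
      rw [← mul_add]; exact mul_le_mul_of_nonneg_left (by linarith) (by positivity)
    have f2 : Eg * (rND * CG) * ρk ≤ Eg * (rND * CG) * (oh + oψ + ρk) := mul_le_mul_of_nonneg_left hρkB (by positivity)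
    calc (cN * oψ + rND * ρk + oh * cN) * Eg * CG = (Eg * (cN * CG) * oψ + Eg * (cN * CG) * oh) + Eg * (rND * CG) * ρk := by ring
      _ ≤ Eg * (cN * CG) * (oh + oψ + ρk) + Eg * (rND * CG) * (oh + oψ + ρk) := add_le_add f1 f2
      _ = Eg * (cN * CG + rND * CG) * (oh + oψ + ρk) := by ring
  have hbr : cN * Eg * (CD * ρk) + cN * Eg * ((d + 1) * (C₁ / ((L ^ k : ℕ) : ℝ))) + (cN * oψ + rND * ρk + oh * cN) * Eg * CG ≤
      Eg * ((cN * CD + cN * ((d + 1) * C₁) + cN * CG + rND * CG) * (oh + oψ + ρk)) :=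
    calc cN * Eg * (CD * ρk) + cN * Eg * ((d + 1) * (C₁ / ((L ^ k : ℕ) : ℝ))) + (cN * oψ + rND * ρk + oh * cN) * Eg * CG
        ≤ Eg * (cN * CD) * (oh + oψ + ρk) + Eg * (cN * ((d + 1) * C₁)) * (oh + oψ + ρk) + Eg * (cN * CG + rND * CG) * (oh + oψ + ρk) :=
          add_le_add (add_le_add e1 e2) e3
      _ = Eg * ((cN * CD + cN * ((d + 1) * C₁) + cN * CG + rND * CG) * (oh + oψ + ρk)) := by ring
  have hpre : 0 ≤ 2 ^ (d + 1) * Real.exp δ₀ * cr := by positivity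
  calc 2 ^ (d + 1) * Real.exp δ₀ * cr * (cN * Eg * (CD * ρk) + cN * Eg * ((d + 1) * (C₁ / ((L ^ k : ℕ) : ℝ))) + (cN * oψ + rND * ρk + oh * cN) * Eg * CG)
      ≤ 2 ^ (d + 1) * Real.exp δ₀ * cr * (Eg * ((cN * CD + cN * ((d + 1) * C₁) + cN * CG + rND * CG) * (oh + oψ + ρk))) := mul_le_mul_of_nonneg_left hbr hpre
    _ = (2 ^ (d + 1) * Real.exp δ₀ * cr * (cN * CD + cN * ((d + 1) * C₁) + cN * CG + rND * CG)) * (oh + oψ + ρk) * Eg := by ring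
    _ ≤ cT * (oh + oψ + ρk) * Eg := by
        refine mul_le_mul_of_nonneg_right (mul_le_mul_of_nonneg_right ?_ hB) hEg
        rw [hcTdef]; linarith
    _ = cT * (oh + oψ + ((L ^ k : ℕ) : ℝ) ^ (-(γ / 2))) * Eg := by rw [hρkdef]

end Defect

end Summit.QuantumFields.YangMills.BalabanUVNodes.N15.TwoGrid

end
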